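import Mathlib
import Summits.Ventures.DiscreteObjects.Mahler.TraceDiscCertificate

/-!
# General trace certificate: any number of outer real trace roots and complex pairs (venture `DiscreteObjects`, target L)

Cell `pub-namedobj`, seat `pub-namedobj-mahler` (gen 11). Framing: lottery ticket; floor = certified
bounds/negative ranges.

The certificates `salem_certificate_of_signs` (`ν = 1`), `nu2/nu3_certificate_of_signs`, `twoPairs(_outer)_certificate`
cover trace polynomials with at most one outer real root and at most two complex pairs.  Census cores of degree `20–26`
and the height-1 rows of degree `46, 48` also show two outer real roots, three or four complex pairs, etc.  This file
gives ONE certificate for every configuration: the instance supplies the inner sign-change brackets, a LIST of outer real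
roots (each from `exists_root_in_bracket`) with `x`-brackets, and a LIST of upper-half-plane roots (each from a disc
certificate `exists_root_near_ofCoeffs`) with `r`-brackets; the product formula `traceRealComplex_structure` then gives
`(∏ xL)·(∏ rL²) ≤ M(traceLift Q) ≤ (∏ xU)·(∏ rU²)`.

* `exists_root_in_bracket` — IVT in `aeval` form;
* `im_pos_of_near`, `ne_of_near` — disc data ⇒ upper half plane / distinct roots;
* `quadRoot_bounds` — `2 < m ≤ |t| ≤ M'`, `xL + xL⁻¹ < m`, `M' < xU + xU⁻¹` ⇒ `xL < (|t| + √(t² - 4))/2 < xU`;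
* `quad_measure_lt_of_near` — disc data and rational square-root brackets ⇒ `rL < M(x² - yx + 1) < rU`;
* `prod_bounds_of_forall₂` — termwise brackets ⇒ product brackets;
* `trace_general_certificate` — the certificate.
-/

namespace Summit.Ventures.DiscreteObjects.Mahler

open Polynomial

/-- IVT for `aeval`: a sign change of `Q` on `(a, b)` gives a real root in `(a, b)`. -/
theorem exists_root_in_bracket (Q : ℤ[X]) {a b : ℝ} (hab : a < b) (hsign : aeval a Q * aeval b Q < 0) :
    ∃ t : ℝ, a < t ∧ t < b ∧ aeval t Q = 0 := by
  have hg : Continuous fun y : ℝ => aeval y Q := by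
    simp only [← eval_map_algebraMap]; exact Polynomial.continuous _
  exact exists_root_of_mul_neg hg hab hsign

/-- A point within `ρ < v` of `u + vi` lies in the upper half plane. -/
theorem im_pos_of_near {y : ℂ} {u v ρ : ℝ} (hy : ‖y - ⟨u, v⟩‖ ≤ ρ) (hv : ρ < v) : 0 < y.im := by
  have h := (Complex.abs_im_le_norm (y - ⟨u, v⟩)).trans hy
  rw [Complex.sub_im] at h
  have := (abs_le.mp h).1
  simp only at this
  linarith

/-- Points in two separated discs are distinct. -/
theorem ne_of_near {y y' : ℂ} {u v ρ u' v' ρ' : ℝ} (hy : ‖y - ⟨u, v⟩‖ ≤ ρ) (hy' : ‖y' - ⟨u', v'⟩‖ ≤ ρ')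
    (h : ρ + ρ' < |u - u'| ∨ ρ + ρ' < |v - v'|) : y ≠ y' := by
  intro heq
  subst heq
  have h1 := (Complex.abs_re_le_norm (y - ⟨u, v⟩)).trans hy
  have h2 := (Complex.abs_re_le_norm (y - ⟨u', v'⟩)).trans hy'
  have h3 := (Complex.abs_im_le_norm (y - ⟨u, v⟩)).trans hy
  have h4 := (Complex.abs_im_le_norm (y - ⟨u', v'⟩)).trans hy'
  rw [Complex.sub_re] at h1 h2
  rw [Complex.sub_im] at h3 h4
  simp only at h1 h2 h3 h4
  rcases h with h | h
  · have := abs_sub_le u y.re u'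
    rw [abs_sub_comm u y.re] at this
    linarith
  · have := abs_sub_le v y.im v'
    rw [abs_sub_comm v y.im] at this
    linarith

/-- `x`-bracket for an outer real trace root: `2 < m ≤ |t| ≤ M'`, `xL + xL⁻¹ < m`, `M' < xU + xU⁻¹` (`xL, xU ≥ 1`) give
`xL < (|t| + √(t² - 4))/2 < xU`. -/
theorem quadRoot_bounds {t m M' xL xU : ℝ} (hm : 2 < m) (hmt : m ≤ |t|) (htM : |t| ≤ M') (hxL : 1 ≤ xL)
    (hxL' : xL + xL⁻¹ < m) (hxU : 1 ≤ xU) (hxU' : M' < xU + xU⁻¹) :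
    1 ≤ xL ∧ xL ≤ (|t| + Real.sqrt (t ^ 2 - 4)) / 2 ∧ (|t| + Real.sqrt (t ^ 2 - 4)) / 2 ≤ xU := by
  obtain ⟨hx1, hxA⟩ := quadRoot_add_inv (lt_of_lt_of_le hm hmt)
  refine ⟨hxL, (lt_of_add_inv_lt_add_inv hx1.le (by linarith) (by rw [hxA]; linarith)).le,
    (lt_of_add_inv_lt_add_inv hxU (by linarith) (by rw [hxA]; linarith)).le⟩

/-- `r`-bracket for a complex trace root from disc data (cf. `quad_measure_bounds_of_near`):
`rL < M(x² - yx + 1) < rU`. -/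
theorem quad_measure_lt_of_near {y : ℂ} {u v ρ gm gp Gm Gp rL rU : ℝ} (hy : ‖y - ⟨u, v⟩‖ ≤ ρ)
    (hgm : gm ^ 2 ≤ (u - 2) ^ 2 + v ^ 2) (hGm : (u - 2) ^ 2 + v ^ 2 ≤ Gm ^ 2) (hGm0 : 0 ≤ Gm)
    (hgp : gp ^ 2 ≤ (u + 2) ^ 2 + v ^ 2) (hGp : (u + 2) ^ 2 + v ^ 2 ≤ Gp ^ 2) (hGp0 : 0 ≤ Gp)
    (hrL : 1 ≤ rL) (hrL' : rL + rL⁻¹ < (gm + gp) / 2 - ρ) (hrU : 1 ≤ rU) (hrU' : (Gm + Gp) / 2 + ρ < rU + rU⁻¹) :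
    1 ≤ rL ∧ rL ≤ (X ^ 2 - C y * X + 1 : ℂ[X]).mahlerMeasure ∧ (X ^ 2 - C y * X + 1 : ℂ[X]).mahlerMeasure ≤ rU := by
  obtain ⟨r, hr1, hrM, hlo, hhi⟩ := quad_measure_bounds_of_near hy hgm hGm hGm0 hgp hGp hGp0
  rw [hrM]
  exact ⟨hrL, (lt_of_add_inv_lt_add_inv hr1 (by linarith) (by linarith)).le,
    (lt_of_add_inv_lt_add_inv hrU (by linarith) (by linarith)).le⟩

/-- Termwise brackets `1 ≤ b.1 ≤ g a ≤ b.2` along `Forall₂` give product brackets (and both products `≥ 1`). -/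
theorem prod_bounds_of_forall₂ {α : Type*} {g : α → ℝ} :
    ∀ {l : List α} {B : List (ℝ × ℝ)}, List.Forall₂ (fun a b => 1 ≤ b.1 ∧ b.1 ≤ g a ∧ g a ≤ b.2) l B →
      (B.map Prod.fst).prod ≤ (l.map g).prod ∧ (l.map g).prod ≤ (B.map Prod.snd).prod ∧
        1 ≤ (l.map g).prod ∧ 1 ≤ (B.map Prod.fst).prod
  | [], [], _ => by simp
  | a :: l, b :: B, h => by
    rw [List.forall₂_cons] at h
    obtain ⟨⟨h1, h2, h3⟩, h'⟩ := h
    obtain ⟨ih1, ih2, ih3, ih4⟩ := prod_bounds_of_forall₂ h'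
    simp only [List.map_cons, List.prod_cons]
    have hga : 1 ≤ g a := le_trans h1 h2
    exact ⟨mul_le_mul h2 ih1 (zero_le_one.trans ih4) (zero_le_one.trans hga),
      mul_le_mul h3 ih2 (zero_le_one.trans ih3) (zero_le_one.trans (hga.trans h3)),
      one_le_mul_of_one_le_of_one_le hga ih3, one_le_mul_of_one_le_of_one_le h1 ih4⟩
  | [], _ :: _, h => by simp at h
  | _ :: _, [], h => by simp at h

/-- **General trace certificate.**  `Q ∈ ℤ[X]` monic of degree `d`; `I` inner sign-change brackets in `(-2, 2)`;
`T₀` a list of distinct real roots with `|t| > 2` and `Y` a list of distinct upper-half-plane roots (supplied by the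
instance from `exists_root_in_bracket` / disc certificates) with `|I| + |T₀| + 2|Y| = d`; `x`-brackets `Xs` for `T₀`
and `r`-brackets `Rs` for `Y` (termwise, `Forall₂`, as produced by `quadRoot_bounds` / `quad_measure_lt_of_near`).
Then `(∏ xL)(∏ rL²) ≤ M(traceLift Q) ≤ (∏ xU)(∏ rU²)`, hence `lo < M(traceLift Q) < hi` for rational `lo, hi` beyond. -/
theorem trace_general_certificate {Q : ℤ[X]} (hQ : Q.Monic) (I : List (ℝ × ℝ))
    (hI : ∀ ab ∈ I, -2 < ab.1 ∧ ab.1 < ab.2 ∧ ab.2 < 2)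
    (hsorted : I.Pairwise (fun ab cd => ab.2 ≤ cd.1))
    (hsign : ∀ ab ∈ I, aeval ab.1 Q * aeval ab.2 Q < 0)
    (T₀ : List ℝ) (hT₀root : ∀ t ∈ T₀, aeval t Q = 0) (hT₀out : ∀ t ∈ T₀, 2 < |t|) (hT₀nodup : T₀.Nodup)
    (Y : List ℂ) (hYroot : ∀ y ∈ Y, aeval y Q = 0) (hYim : ∀ y ∈ Y, 0 < y.im) (hYnodup : Y.Nodup)
    (hcount : I.length + T₀.length + 2 * Y.length = Q.natDegree)
    (Xs : List (ℝ × ℝ))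
    (hXs : List.Forall₂ (fun t x => 1 ≤ x.1 ∧ x.1 ≤ (|t| + Real.sqrt (t ^ 2 - 4)) / 2 ∧
      (|t| + Real.sqrt (t ^ 2 - 4)) / 2 ≤ x.2) T₀ Xs)
    (Rs : List (ℝ × ℝ))
    (hRs : List.Forall₂ (fun y r => 1 ≤ r.1 ∧ r.1 ≤ (X ^ 2 - C y * X + 1 : ℂ[X]).mahlerMeasure ∧
      (X ^ 2 - C y * X + 1 : ℂ[X]).mahlerMeasure ≤ r.2) Y Rs)
    {lo hi : ℝ} (hlo : lo < (Xs.map Prod.fst).prod * (Rs.map fun r => r.1 ^ 2).prod)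
    (hhi : (Xs.map Prod.snd).prod * (Rs.map fun r => r.2 ^ 2).prod < hi) :
    lo < intMahlerMeasure (traceLift Q) ∧ intMahlerMeasure (traceLift Q) < hi := by
  classical
  -- inner roots
  have hg : Continuous fun y : ℝ => aeval y Q := by
    simp only [← eval_map_algebraMap]; exact Polynomial.continuous _
  obtain ⟨rs, hrslen, hrspw, hroots, -, -, -, -⟩ := exists_roots_in_intervals hg I hI hsorted hsign
  have hrs2 : ∀ r ∈ rs, -2 < r ∧ r < 2 := by
    intro r hr
    obtain ⟨-, cd, hcd, h1, h2⟩ := hroots r hr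
    obtain ⟨h3, -, h4⟩ := hI cd hcd
    exact ⟨by linarith, by linarith⟩
  have hrsabs : ∀ r ∈ rs, |r| ≤ 2 := fun r hr => abs_le.mpr ⟨(hrs2 r hr).1.le, (hrs2 r hr).2.le⟩
  -- all real roots
  set T : Multiset ℝ := (rs : Multiset ℝ) + (T₀ : Multiset ℝ) with hT
  have hTnodup : T.Nodup := by
    rw [hT, Multiset.nodup_add]
    refine ⟨Multiset.coe_nodup.mpr (hrspw.imp ne_of_lt), Multiset.coe_nodup.mpr hT₀nodup, Multiset.disjoint_left.mpr ?_⟩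
    intro t ht ht'
    rw [Multiset.mem_coe] at ht ht'
    have := hrsabs t ht; have := hT₀out t ht'; linarith
  have hTroot : ∀ t ∈ T, aeval t Q = 0 := by
    intro t ht
    rcases Multiset.mem_add.mp ht with h | h
    · exact (hroots t (Multiset.mem_coe.mp h)).1
    · exact hT₀root t (Multiset.mem_coe.mp h)
  have hYn : (Y : Multiset ℂ).Nodup := Multiset.coe_nodup.mpr hYnodup
  have hcard : Multiset.card T + 2 * Multiset.card (Y : Multiset ℂ) = Q.natDegree := by
    rw [hT, Multiset.card_add, Multiset.coe_card, Multiset.coe_card, Multiset.coe_card, hrslen, ← hcount]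
  have hM := traceRealComplex_structure hQ T hTnodup hTroot (Y : Multiset ℂ) hYn
    (fun y hy => hYroot y (Multiset.mem_coe.mp hy)) (fun y hy => hYim y (Multiset.mem_coe.mp hy)) hcard
  -- the product over `T`: inner part is `1`, outer part is bracketed by `Xs`
  set f : ℝ → ℝ := fun t => if |t| ≤ 2 then (1 : ℝ) else (|t| + Real.sqrt (t ^ 2 - 4)) / 2 with hf
  have hinner : ((rs : Multiset ℝ).map f).prod = 1 := by
    have : ((rs : Multiset ℝ).map f) = (rs : Multiset ℝ).map fun _ => (1 : ℝ) :=
      Multiset.map_congr rfl fun t ht => by rw [hf]; simp only; rw [if_pos (hrsabs t (Multiset.mem_coe.mp ht))]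
    rw [this, Multiset.map_const', Multiset.prod_replicate, one_pow]
  have houter : ((T₀ : Multiset ℝ).map f).prod = (T₀.map fun t => (|t| + Real.sqrt (t ^ 2 - 4)) / 2).prod := by
    rw [Multiset.map_coe, Multiset.prod_coe]
    congr 1
    exact List.map_congr_left fun t ht => by rw [hf]; simp only; rw [if_neg (not_le.mpr (hT₀out t ht))]
  rw [hT, Multiset.map_add, Multiset.prod_add, hinner, one_mul, houter, Multiset.map_coe, Multiset.prod_coe] at hM
  -- product brackets
  obtain ⟨hx1, hx2, hx3, hx4⟩ := prod_bounds_of_forall₂ hXs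
  have hRs' : List.Forall₂ (fun y r => 1 ≤ r.1 ∧ r.1 ≤ (X ^ 2 - C y * X + 1 : ℂ[X]).mahlerMeasure ^ 2 ∧
      (X ^ 2 - C y * X + 1 : ℂ[X]).mahlerMeasure ^ 2 ≤ r.2) Y (Rs.map fun r => (r.1 ^ 2, r.2 ^ 2)) := by
    rw [List.forall₂_map_right_iff]
    refine hRs.imp fun {y r} h => ?_
    obtain ⟨h1, h2, h3⟩ := h
    have h0 : 0 ≤ r.1 := zero_le_one.trans h1
    exact ⟨one_le_pow₀ h1, pow_le_pow_left₀ h0 h2 2, pow_le_pow_left₀ (h0.trans h2) h3 2⟩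
  obtain ⟨hr1, hr2, hr3, hr4⟩ := prod_bounds_of_forall₂ hRs'
  have e1 : (Rs.map fun r => (r.1 ^ 2, r.2 ^ 2)).map Prod.fst = Rs.map fun r => r.1 ^ 2 := by
    rw [List.map_map]; rfl
  have e2 : (Rs.map fun r => (r.1 ^ 2, r.2 ^ 2)).map Prod.snd = Rs.map fun r => r.2 ^ 2 := by
    rw [List.map_map]; rfl
  rw [e1] at hr1 hr4; rw [e2] at hr2
  rw [hM]
  constructor
  · calc lo < (Xs.map Prod.fst).prod * (Rs.map fun r => r.1 ^ 2).prod := hlo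
      _ ≤ (T₀.map fun t => (|t| + Real.sqrt (t ^ 2 - 4)) / 2).prod *
          (Y.map fun y => (X ^ 2 - C y * X + 1 : ℂ[X]).mahlerMeasure ^ 2).prod :=
        mul_le_mul hx1 hr1 (zero_le_one.trans hr4) (zero_le_one.trans hx3)
  · calc (T₀.map fun t => (|t| + Real.sqrt (t ^ 2 - 4)) / 2).prod *
          (Y.map fun y => (X ^ 2 - C y * X + 1 : ℂ[X]).mahlerMeasure ^ 2).prod
        ≤ (Xs.map Prod.snd).prod * (Rs.map fun r => r.2 ^ 2).prod :=
          mul_le_mul hx2 hr2 (zero_le_one.trans hr3) (zero_le_one.trans (hx3.trans hx2))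
      _ < hi := hhi

end Summit.Ventures.DiscreteObjects.Mahler
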